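import Literature.AlgebraicGeometry.Resolution.RegularLocusDense
import Mathlib.AlgebraicGeometry.Morphisms.Proper
import Mathlib.AlgebraicGeometry.Morphisms.Preimmersion
import Mathlib.AlgebraicGeometry.Morphisms.Flat

/-!
# `Descent.DescentPerfectToAll`, line `arc-special-fibre-transversality`: propagation of regularity

Route `ResolutionOfSingularities/Descent`, crux `DescentPerfectToAll`
(stmt-ResolutionOfSingularities-0549), stub `stub_propagation` of the lead's skeleton
`work/DescentPerfectToAll.lean`, PROVED here (statement verbatim from the ledger registration).

**Statement (PROPAGATION).** Let `R` be a local domain and `g : 𝒴 → Spec R` a proper morphism with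
`𝒴` quasi-excellent, such that the local ring `𝒪_{𝒴,y}` is regular at every point `y` of the CLOSED
fibre (`g y =` the closed point of `Spec R`).  Then `𝒴` is regular, and so is its generic fibre
`𝒴 ×_{Spec R} Spec (Frac R)`.

**Proof.**
* `𝒴` is regular (EGA IV₂ 7.8.6): the regular locus `Reg 𝒴` is open (J-2 for the quasi-excellent
  `𝒴`, in-tree `Scheme.isOpen_regularLocus_of_isQuasiExcellent`).  A proper morphism is
  (universally) closed, and a closed map is specialising: since `g y` specialises to the closed
  point of the local scheme `Spec R`, some specialisation `z` of `y` lies over the closed point, so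
  `z ∈ Reg 𝒴` by hypothesis, and the open `Reg 𝒴` contains the generisation `y` of `z`.
* the generic fibre: the projection `𝒴 ×_R Frac R → 𝒴` is the base change of
  `Spec (Frac R) → Spec R`, which is flat (a localisation) and a preimmersion (surjective on
  stalks), so it is itself flat and surjective on stalks.  Its stalk maps
  `𝒪_{𝒴,y} → 𝒪_{𝒴 ×_R Frac R, q}` are therefore flat LOCAL (hence faithfully flat, hence injective)
  surjections, i.e. ring isomorphisms, and `𝒪_{𝒴,y}` is regular by the first part.
-/

noncomputable section

set_option linter.dupNamespace false -- mandated namespace of this single-conjunct summit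

open CategoryTheory CategoryTheory.Limits AlgebraicGeometry Topology
open Literature.AlgebraicGeometry.Resolution

namespace Summit.ResolutionOfSingularities.ResolutionOfSingularities.Theorems

universe u

/-- **Regularity spreads from the closed fibre** (EGA IV₂ 7.8.6 + properness): if `g : 𝒴 → Spec R`
(`R` local) is universally closed, `𝒴` is quasi-excellent and `𝒪_{𝒴,y}` is regular for every `y`
over the closed point, then `𝒴` is regular.  Every point specialises into the closed fibre (closed
maps are specialising) and the regular locus is open, hence stable under generisation. -/
theorem isRegular_of_isRegularLocalRing_closedFibre {R : Type u} [CommRing R] [IsLocalRing R]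
    {𝒴 : Scheme.{u}} (g : 𝒴 ⟶ Spec (.of R)) [UniversallyClosed g]
    (hqe : Scheme.IsQuasiExcellent 𝒴)
    (hcl : ∀ y : 𝒴, g.base y = IsLocalRing.closedPoint R → IsRegularLocalRing (𝒴.presheaf.stalk y)) :
    Scheme.IsRegular 𝒴 := by
  intro y
  have hspec : SpecializingMap g.base := g.isClosedMap.specializingMap
  obtain ⟨z, hyz, hz⟩ := hspec (IsLocalRing.specializes_closedPoint (g.base y))
  exact (show y ⤳ z from hyz).mem_open (Scheme.isOpen_regularLocus_of_isQuasiExcellent hqe)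
    (hcl z hz)

/-- The stalk maps of a flat morphism which is surjective on stalks are bijective: a flat local
homomorphism of local rings is faithfully flat, hence injective. -/
theorem stalkMap_bijective_of_flat_of_surjectiveOnStalks {P Y : Scheme.{u}} (f : P ⟶ Y) [Flat f]
    [SurjectiveOnStalks f] (q : P) : Function.Bijective (f.stalkMap q).hom := by
  refine ⟨?_, f.stalkMap_surjective q⟩
  algebraize [(f.stalkMap q).hom]
  have : Module.FaithfullyFlat (Y.presheaf.stalk (f.base q)) (P.presheaf.stalk q) :=
    @Module.FaithfullyFlat.of_flat_of_isLocalHom _ _ _ _ _ _ _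
      (Flat.stalkMap f q) (f.toLRSHom.prop q)
  exact ‹RingHom.FaithfullyFlat _›.injective

/-- A scheme admitting a flat morphism, surjective on stalks, to a regular scheme is regular (its
local rings are isomorphic to local rings of the target). -/
theorem isRegular_of_flat_of_surjectiveOnStalks {P Y : Scheme.{u}} (f : P ⟶ Y) [Flat f]
    [SurjectiveOnStalks f] (hY : Scheme.IsRegular Y) : Scheme.IsRegular P := by
  intro q
  haveI := hY (f.base q)
  exact IsRegularLocalRing.of_ringEquiv
    (RingEquiv.ofBijective (f.stalkMap q).hom (stalkMap_bijective_of_flat_of_surjectiveOnStalks f q))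

/-- `Spec (Frac R) → Spec R` is flat (a localisation). -/
theorem flat_SpecMap_algebraMap_fractionRing (R : Type u) [CommRing R] :
    Flat (Spec.map (CommRingCat.ofHom (algebraMap R (FractionRing R)))) := by
  rw [Flat.SpecMap_iff, CommRingCat.hom_ofHom]
  exact RingHom.flat_algebraMap_iff.mpr (IsLocalization.flat (FractionRing R) (nonZeroDivisors R))

/-- `Spec (Frac R) → Spec R` is a preimmersion (a localisation). -/
theorem isPreimmersion_SpecMap_algebraMap_fractionRing (R : Type u) [CommRing R] :
    IsPreimmersion (Spec.map (CommRingCat.ofHom (algebraMap R (FractionRing R)))) :=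
  IsPreimmersion.of_isLocalization (nonZeroDivisors R)

/-- The generic fibre `𝒴 ×_{Spec R} Spec (Frac R)` of a regular `R`-scheme is regular: its local
rings are local rings of `𝒴`. -/
theorem isRegular_genericFibre {R : Type u} [CommRing R] {𝒴 : Scheme.{u}}
    (g : 𝒴 ⟶ Spec (.of R)) (h𝒴 : Scheme.IsRegular 𝒴) :
    Scheme.IsRegular
      (pullback g (Spec.map (CommRingCat.ofHom (algebraMap R (FractionRing R))))) :=
  haveI := flat_SpecMap_algebraMap_fractionRing R
  haveI := isPreimmersion_SpecMap_algebraMap_fractionRing R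
  isRegular_of_flat_of_surjectiveOnStalks (pullback.fst g _) h𝒴

-- registered signature; both hypotheses are used (FractionRing / closedPoint)
set_option linter.overlappingInstances false in
/-- **PROPAGATION** (stub `stub_propagation`, EGA IV₂ 7.8.6): for a local domain `R` and a proper
quasi-excellent `g : 𝒴 → Spec R` whose local rings at the points of the closed fibre are regular,
`𝒴` is regular and so is its generic fibre `𝒴 ×_R Frac R`. -/
theorem stub_propagation : ∀ (R : Type) [CommRing R] [IsDomain R] [IsLocalRing R] (𝒴 : Scheme.{0}) (g : 𝒴 ⟶ Spec (.of R)), IsProper g → Scheme.IsQuasiExcellent 𝒴 → (∀ y : 𝒴, g.base y = IsLocalRing.closedPoint R → IsRegularLocalRing (𝒴.presheaf.stalk y)) → Scheme.IsRegular 𝒴 ∧ Scheme.IsRegular (pullback g (Spec.map (CommRingCat.ofHom (algebraMap R (FractionRing R))))) := by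
  intro R _ _ _ 𝒴 g hg hqe hcl
  have h𝒴 : Scheme.IsRegular 𝒴 := isRegular_of_isRegularLocalRing_closedFibre g hqe hcl
  exact ⟨h𝒴, isRegular_genericFibre g h𝒴⟩

end Summit.ResolutionOfSingularities.ResolutionOfSingularities.Theorems

end
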